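import Summits.Ventures.Crystal3D.Theorems.StickyWulffConstantGenericWallFloorStarFarCheck
import HarnessLib

/-!
# Kernel discharge of `StarPairFar`, task file 3 of 8: evaluation of the branch and bound on chart 1: block (1,3) with second index ≠ 0 and block (1,4) with second index 0 (64 tasks)

HONEST FRAMING. Venture `Summits/Ventures/Crystal3D` (cell `crystal3d-full`), helper `--supports` the crux
`GenericWallFloor` (stmt-Ventures-19480) of `route-Ventures-StickyWulffConstant`, line `WallLedgerG`.  Rung credit only;
F-C1 not moved.  COMPUTATIONAL GRADE: `native_decide` (trust base = Lean's compiler/interpreter via `Lean.ofReduceBool`)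
evaluates `checkTask` of part 3 (`…StarFarCheck`) — the self-recomputing exact-integer interval branch and bound of
wulff-p2 g10's lineage-B′ certifier of `StarPairFar` — on the tasks listed in `tasks3`; no certificate data are read.
The eight task files partition the `4 × 8³ = 2048` top tasks (charts × eighths); parts 4–5 turn `checkTask = true` into
the real statement, the final file assembles `StarPairFar`.  Expected evaluation cost of this file (seat measurement,
farm interpreter): about 50 s.
-/

namespace Summit.Ventures.Crystal3D.Theorems.StarFar

/-- The tasks of this file: chart 1: block (1,3) with second index ≠ 0 and block (1,4) with second index 0 (64 tasks). -/
def tasks3 : List Task :=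
  ((taskBlock 1 3).filter fun t => t.2.2.1 ≠ 0) ++ ((taskBlock 1 4).filter fun t => t.2.2.1 = 0)

/-- **Every task of this file passes the branch and bound** (evaluation by `native_decide`). -/
theorem tasks3_ok : tasks3.all checkTask = true := by
  native_decide

end Summit.Ventures.Crystal3D.Theorems.StarFar
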